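import Literature.Probability.Distributions.GaussianHermiteChaos
import Mathlib.MeasureTheory.Integral.Prod
import HarnessLib

/-!
# The rectangle (mixed-energy) form of a Wick polynomial along a coordinate direction

Fix an orthonormal basis `b` of the finite-dimensional real inner product space `E`, an index
`i₀` and `ω = b i₀`. For a function `g : E → ℝ` the *rectangle increment along `ω`* at
`((c, s), (z, z_*)) ∈ (ℝ × ℝ) × (E × E)` is
`R g = G(c, z) - G(s, z) - G(c, z_*) + G(s, z_*)`, `G(c, z) = g(c ω + (z - ⟪z, ω⟫ ω))`
(`rectIncr`), and we integrate `(R g)²` against `(γ₁ ⊗ γ₁) ⊗ (γ ⊗ γ)` (`γ₁ = gaussianReal 0 1`,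
`γ = stdGaussian E`). For a Wick polynomial `g = 𝓗_b p` (`hermiteEval`) we prove the
**mixed-energy identity**

`∫ (R 𝓗_b p)² = 4 Σ_{α : αᵢ₀ ≥ 1, α ≠ αᵢ₀ eᵢ₀} α! p_α²` (`integral_rectIncr_sq_hermiteEval`):

in the coordinates adapted to `ω`, `H_α(c ω + P z) = He_{αᵢ₀}(c) · H_{α - αᵢ₀ eᵢ₀}(z)`, the
rectangle increment kills every Hermite mode that is constant in `c` (`αᵢ₀ = 0`) or constant in
`z` (`α = αᵢ₀ eᵢ₀`), and is an isometry (up to the factor `4 = 2 · 2`) on the remaining "mixed"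
modes, by the orthogonality relations `∫ Heₘ Heₙ dγ₁ = n! δ`, `∫ H_α H_β dγ = α! δ`.
Equivalently `¼ ∫ (R g)² = ‖g‖² - ‖E[g | ⟪·,ω⟫]‖² - ‖E[g | P_{ω⊥} ·]‖² + (E g)²`.

This is the per-direction computation behind the spectral gap of the `ω`-isotropic
pseudo-Maxwellian linearised Boltzmann operator
(`Literature.Analysis.UnboundedOperators.LinearizedBoltzmann`).
-/

open MeasureTheory ProbabilityTheory Polynomial Finset
open scoped InnerProductSpace Nat

namespace Literature.Probability.Distributions

open Literature.Algebra.Polynomial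

noncomputable section

variable {E : Type*} [NormedAddCommGroup E] [InnerProductSpace ℝ E]
variable {ι : Type*} [Fintype ι] [DecidableEq ι]

/-- The rectangle increment of `g` along `ω` at `((c, s), (z, z_*))`:
`g(cω + Pz) - g(sω + Pz) - g(cω + Pz_*) + g(sω + Pz_*)`, `P z = z - ⟪z, ω⟫ ω`. [folklore] -/
def rectIncr (ω : E) (g : E → ℝ) (q : (ℝ × ℝ) × (E × E)) : ℝ :=
  g (q.1.1 • ω + (q.2.1 - ⟪q.2.1, ω⟫_ℝ • ω)) - g (q.1.2 • ω + (q.2.1 - ⟪q.2.1, ω⟫_ℝ • ω)) -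
    g (q.1.1 • ω + (q.2.2 - ⟪q.2.2, ω⟫_ℝ • ω)) + g (q.1.2 • ω + (q.2.2 - ⟪q.2.2, ω⟫_ℝ • ω))

/-- The **mixed energy** of a polynomial relative to the coordinate `i₀`:
`Σ_{α : αᵢ₀ ≥ 1, α.erase i₀ ≠ 0} α! p_α²`, the Fischer energy of the Hermite modes depending
both on `xᵢ₀` and on the other coordinates. [folklore] -/
def mixedEnergy (i₀ : ι) (p : MvPolynomial ι ℝ) : ℝ :=
  ∑ α ∈ p.support, if 1 ≤ α i₀ ∧ α.erase i₀ ≠ 0 then mfactorial α * MvPolynomial.coeff α p ^ 2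
    else 0

/-- The mixed-energy sum may run over any finite set containing the support. [folklore] -/
theorem mixedEnergy_eq_sum_of_subset (i₀ : ι) {p : MvPolynomial ι ℝ} {s : Finset (ι →₀ ℕ)}
    (h : p.support ⊆ s) :
    mixedEnergy i₀ p = ∑ α ∈ s, if 1 ≤ α i₀ ∧ α.erase i₀ ≠ 0 then
      mfactorial α * MvPolynomial.coeff α p ^ 2 else 0 := by
  unfold mixedEnergy
  refine Finset.sum_subset h fun α _ hα => ?_
  rw [MvPolynomial.notMem_support_iff.1 hα]
  simp

/-- `0 ≤ mixedEnergy`. [folklore] -/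
theorem mixedEnergy_nonneg (i₀ : ι) (p : MvPolynomial ι ℝ) : 0 ≤ mixedEnergy i₀ p :=
  Finset.sum_nonneg fun α _ => by
    split_ifs
    · exact mul_nonneg (mfactorial_pos α).le (sq_nonneg _)
    · exact le_rfl

/-! ### Hermite functions in adapted coordinates -/

/-- Coordinates of a fibre point: `⟪bᵢ, c bᵢ₀ + (z - ⟪z, bᵢ₀⟫ bᵢ₀)⟫` is `c` for `i = i₀` and
`⟪bᵢ, z⟫` otherwise. [folklore] -/
theorem inner_basis_fibre (b : OrthonormalBasis ι ℝ E) (i₀ i : ι) (c : ℝ) (z : E) :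
    ⟪b i, c • b i₀ + (z - ⟪z, b i₀⟫_ℝ • b i₀)⟫_ℝ = if i = i₀ then c else ⟪b i, z⟫_ℝ := by
  classical
  have hon := orthonormal_iff_ite.1 b.orthonormal
  simp only [inner_add_right, inner_sub_right, inner_smul_right, hon i i₀, real_inner_comm z]
  split_ifs with h
  · subst h; ring
  · ring

/-- **Separation of variables**: `H_α(c bᵢ₀ + P z) = He_{αᵢ₀}(c) · H_{α.erase i₀}(z)`. [folklore] -/
theorem hermiteProd_fibre (b : OrthonormalBasis ι ℝ E) (i₀ : ι) (α : ι →₀ ℕ) (c : ℝ) (z : E) :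
    hermiteProd b α (c • b i₀ + (z - ⟪z, b i₀⟫_ℝ • b i₀)) =
      (hermiteR (α i₀)).eval c * hermiteProd b (α.erase i₀) z := by
  unfold hermiteProd
  simp_rw [inner_basis_fibre]
  rw [← Finset.mul_prod_erase Finset.univ _ (Finset.mem_univ i₀), if_pos rfl,
    ← Finset.mul_prod_erase Finset.univ (fun i => (hermiteR ((α.erase i₀) i)).eval ⟪b i, z⟫_ℝ)
      (Finset.mem_univ i₀)]
  simp only [Finsupp.erase_same, hermiteR_zero, eval_one, one_mul]
  congr 1
  refine Finset.prod_congr rfl fun i hi => ?_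
  rw [if_neg (Finset.ne_of_mem_erase hi), Finsupp.erase_ne (Finset.ne_of_mem_erase hi)]

/-- A Wick polynomial at a fibre point: `𝓗_b p (c bᵢ₀ + P z) = Σ_α p_α He_{αᵢ₀}(c) H_{α.erase i₀}(z)`. [folklore] -/
theorem hermiteEval_fibre (b : OrthonormalBasis ι ℝ E) (i₀ : ι) (p : MvPolynomial ι ℝ) (c : ℝ)
    (z : E) :
    hermiteEval b p (c • b i₀ + (z - ⟪z, b i₀⟫_ℝ • b i₀)) =
      ∑ α ∈ p.support, MvPolynomial.coeff α p *
        ((hermiteR (α i₀)).eval c * hermiteProd b (α.erase i₀) z) := by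
  simp only [hermiteEval, hermiteProd_fibre]

/-- The rectangle increment of a Wick polynomial, mode by mode:
`R(𝓗_b p) = Σ_α p_α (He_{αᵢ₀}(c) - He_{αᵢ₀}(s)) (H_{α'}(z) - H_{α'}(z_*))`. [folklore] -/
theorem rectIncr_hermiteEval (b : OrthonormalBasis ι ℝ E) (i₀ : ι) (p : MvPolynomial ι ℝ)
    (q : (ℝ × ℝ) × (E × E)) :
    rectIncr (b i₀) (hermiteEval b p) q =
      ∑ α ∈ p.support, MvPolynomial.coeff α p *
        (((hermiteR (α i₀)).eval q.1.1 - (hermiteR (α i₀)).eval q.1.2) *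
          (hermiteProd b (α.erase i₀) q.2.1 - hermiteProd b (α.erase i₀) q.2.2)) := by
  simp only [rectIncr, hermiteEval_fibre, ← Finset.sum_sub_distrib, ← Finset.sum_add_distrib]
  refine Finset.sum_congr rfl fun α _ => ?_
  ring

/-! ### The two one-factor expectations -/

section Gaussian

variable [FiniteDimensional ℝ E] [MeasurableSpace E] [BorelSpace E]

/-- `∫∫ (Heₘ(c) - Heₘ(s))(Heₙ(c) - Heₙ(s)) dγ₁ dγ₁ = 2 (n! δₘₙ - δₘ₀ δₙ₀)`. [folklore] -/
theorem integral_hermiteR_incr_mul (m n : ℕ) :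
    ∫ x : ℝ × ℝ, ((hermiteR m).eval x.1 - (hermiteR m).eval x.2) *
        ((hermiteR n).eval x.1 - (hermiteR n).eval x.2)
      ∂(gaussianReal 0 1).prod (gaussianReal 0 1) =
      2 * ((if m = n then (n ! : ℝ) else 0) - (if m = 0 then 1 else 0) * (if n = 0 then 1 else 0)) := by
  set γ₁ := gaussianReal 0 1
  have hI : ∀ k l : ℕ, Integrable (fun x : ℝ × ℝ => (hermiteR k).eval x.1 * (hermiteR l).eval x.2)
      (γ₁.prod γ₁) := fun k l =>
    (integrable_eval_gaussianReal (hermiteR k) 0 1).mul_prod (integrable_eval_gaussianReal (hermiteR l) 0 1)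
  have hI1 : ∀ k l : ℕ, Integrable (fun x : ℝ × ℝ => (hermiteR k).eval x.1 * (hermiteR l).eval x.1)
      (γ₁.prod γ₁) := fun k l =>
    ((integrable_eval_mul_eval_gaussianReal (hermiteR k) (hermiteR l) 0 1).mul_prod
      (integrable_const (1 : ℝ))).congr (ae_of_all _ fun x => by simp)
  have hI2 : ∀ k l : ℕ, Integrable (fun x : ℝ × ℝ => (hermiteR k).eval x.2 * (hermiteR l).eval x.2)
      (γ₁.prod γ₁) := fun k l =>
    ((integrable_const (1 : ℝ)).mul_prod
      (integrable_eval_mul_eval_gaussianReal (hermiteR k) (hermiteR l) 0 1)).congr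
      (ae_of_all _ fun x => by simp)
  have hexp : ∀ x : ℝ × ℝ, ((hermiteR m).eval x.1 - (hermiteR m).eval x.2) *
      ((hermiteR n).eval x.1 - (hermiteR n).eval x.2) =
      (hermiteR m).eval x.1 * (hermiteR n).eval x.1 - (hermiteR m).eval x.1 * (hermiteR n).eval x.2
        - (hermiteR n).eval x.1 * (hermiteR m).eval x.2 +
        (hermiteR m).eval x.2 * (hermiteR n).eval x.2 := fun x => by ring
  simp_rw [hexp]
  rw [integral_add, integral_sub, integral_sub]
  · -- the four integrals
    have h11 : ∫ x : ℝ × ℝ, (hermiteR m).eval x.1 * (hermiteR n).eval x.1 ∂γ₁.prod γ₁ =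
        if m = n then (n ! : ℝ) else 0 := by
      have := integral_prod_mul (μ := γ₁) (ν := γ₁)
        (fun c : ℝ => (hermiteR m).eval c * (hermiteR n).eval c) (fun _ : ℝ => (1 : ℝ))
      simp only [mul_one, integral_const, probReal_univ, smul_eq_mul] at this
      rw [this, integral_hermiteR_mul_hermiteR]
    have h22 : ∫ x : ℝ × ℝ, (hermiteR m).eval x.2 * (hermiteR n).eval x.2 ∂γ₁.prod γ₁ =
        if m = n then (n ! : ℝ) else 0 := by
      have := integral_prod_mul (μ := γ₁) (ν := γ₁) (fun _ : ℝ => (1 : ℝ))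
        (fun c : ℝ => (hermiteR m).eval c * (hermiteR n).eval c)
      simp only [one_mul, integral_const, probReal_univ, smul_eq_mul] at this
      rw [this, integral_hermiteR_mul_hermiteR]
    have h12 : ∫ x : ℝ × ℝ, (hermiteR m).eval x.1 * (hermiteR n).eval x.2 ∂γ₁.prod γ₁ =
        (if m = 0 then (1 : ℝ) else 0) * (if n = 0 then 1 else 0) := by
      rw [integral_prod_mul (μ := γ₁) (ν := γ₁) (fun c : ℝ => (hermiteR m).eval c)
        (fun c : ℝ => (hermiteR n).eval c), integral_hermiteR, integral_hermiteR]
    have h21 : ∫ x : ℝ × ℝ, (hermiteR n).eval x.1 * (hermiteR m).eval x.2 ∂γ₁.prod γ₁ =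
        (if m = 0 then (1 : ℝ) else 0) * (if n = 0 then 1 else 0) := by
      rw [integral_prod_mul (μ := γ₁) (ν := γ₁) (fun c : ℝ => (hermiteR n).eval c)
        (fun c : ℝ => (hermiteR m).eval c), integral_hermiteR, integral_hermiteR, mul_comm]
    rw [h11, h22, h12, h21]
    ring
  · exact hI1 m n
  · exact hI m n
  · exact (hI1 m n).sub (hI m n)
  · exact hI n m
  · exact ((hI1 m n).sub (hI m n)).sub (hI n m)
  · exact hI2 m n

/-- `∫∫ (H_α(z) - H_α(z_*))(H_β(z) - H_β(z_*)) dγ dγ = 2 (α! δ_{αβ} - δ_{α0} δ_{β0})`. [folklore] -/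
theorem integral_hermiteProd_incr_mul (b : OrthonormalBasis ι ℝ E) (α β : ι →₀ ℕ) :
    ∫ x : E × E, (hermiteProd b α x.1 - hermiteProd b α x.2) *
        (hermiteProd b β x.1 - hermiteProd b β x.2) ∂(stdGaussian E).prod (stdGaussian E) =
      2 * ((if α = β then mfactorial α else 0) -
        (if α = 0 then 1 else 0) * (if β = 0 then 1 else 0)) := by
  classical
  set γ := stdGaussian E
  have hI : ∀ κ ν : ι →₀ ℕ, Integrable (fun x : E × E => hermiteProd b κ x.1 * hermiteProd b ν x.2)
      (γ.prod γ) := fun κ ν => (integrable_hermiteProd b κ).mul_prod (integrable_hermiteProd b ν)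
  have hI1 : ∀ κ ν : ι →₀ ℕ, Integrable (fun x : E × E => hermiteProd b κ x.1 * hermiteProd b ν x.1)
      (γ.prod γ) := fun κ ν =>
    ((integrable_hermiteProd_mul_hermiteProd b κ ν).mul_prod (integrable_const (1 : ℝ))).congr
      (ae_of_all _ fun x => by simp)
  have hI2 : ∀ κ ν : ι →₀ ℕ, Integrable (fun x : E × E => hermiteProd b κ x.2 * hermiteProd b ν x.2)
      (γ.prod γ) := fun κ ν =>
    ((integrable_const (1 : ℝ)).mul_prod (integrable_hermiteProd_mul_hermiteProd b κ ν)).congr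
      (ae_of_all _ fun x => by simp)
  have hexp : ∀ x : E × E, (hermiteProd b α x.1 - hermiteProd b α x.2) *
      (hermiteProd b β x.1 - hermiteProd b β x.2) =
      hermiteProd b α x.1 * hermiteProd b β x.1 - hermiteProd b α x.1 * hermiteProd b β x.2
        - hermiteProd b β x.1 * hermiteProd b α x.2 + hermiteProd b α x.2 * hermiteProd b β x.2 :=
    fun x => by ring
  simp_rw [hexp]
  rw [integral_add, integral_sub, integral_sub]
  · have h11 : ∫ x : E × E, hermiteProd b α x.1 * hermiteProd b β x.1 ∂γ.prod γ =
        if α = β then mfactorial α else 0 := by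
      have := integral_prod_mul (μ := γ) (ν := γ)
        (fun z : E => hermiteProd b α z * hermiteProd b β z) (fun _ : E => (1 : ℝ))
      simp only [mul_one, integral_const, probReal_univ, smul_eq_mul] at this
      rw [this, integral_hermiteProd_mul_hermiteProd]
    have h22 : ∫ x : E × E, hermiteProd b α x.2 * hermiteProd b β x.2 ∂γ.prod γ =
        if α = β then mfactorial α else 0 := by
      have := integral_prod_mul (μ := γ) (ν := γ) (fun _ : E => (1 : ℝ))
        (fun z : E => hermiteProd b α z * hermiteProd b β z)
      simp only [one_mul, integral_const, probReal_univ, smul_eq_mul] at this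
      rw [this, integral_hermiteProd_mul_hermiteProd]
    have h12 : ∫ x : E × E, hermiteProd b α x.1 * hermiteProd b β x.2 ∂γ.prod γ =
        (if α = 0 then (1 : ℝ) else 0) * (if β = 0 then 1 else 0) := by
      rw [integral_prod_mul (μ := γ) (ν := γ) (hermiteProd b α) (hermiteProd b β),
        integral_hermiteProd, integral_hermiteProd]
    have h21 : ∫ x : E × E, hermiteProd b β x.1 * hermiteProd b α x.2 ∂γ.prod γ =
        (if α = 0 then (1 : ℝ) else 0) * (if β = 0 then 1 else 0) := by
      rw [integral_prod_mul (μ := γ) (ν := γ) (hermiteProd b β) (hermiteProd b α),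
        integral_hermiteProd, integral_hermiteProd, mul_comm]
    rw [h11, h22, h12, h21]
    ring
  · exact hI1 α β
  · exact hI α β
  · exact (hI1 α β).sub (hI α β)
  · exact hI β α
  · exact ((hI1 α β).sub (hI α β)).sub (hI β α)
  · exact hI2 α β

/-- The product of the two one-factor expectations collapses to the diagonal:
`E₁(α,β) E₂(α,β) = 4 δ_{αβ} [αᵢ₀ ≥ 1] [α.erase i₀ ≠ 0] α!`. [folklore] -/
theorem incr_expectations_mul (i₀ : ι) (α β : ι →₀ ℕ) :
    (2 * ((if α i₀ = β i₀ then ((β i₀) ! : ℝ) else 0) -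
        (if α i₀ = 0 then 1 else 0) * (if β i₀ = 0 then 1 else 0))) *
      (2 * ((if α.erase i₀ = β.erase i₀ then mfactorial (α.erase i₀) else 0) -
        (if α.erase i₀ = 0 then 1 else 0) * (if β.erase i₀ = 0 then 1 else 0))) =
      if α = β then (if 1 ≤ α i₀ ∧ α.erase i₀ ≠ 0 then 4 * mfactorial α else 0) else 0 := by
  by_cases hαβ : α = β
  · subst hαβ
    simp only [if_true]
    have hfac : mfactorial α = ((α i₀) ! : ℝ) * mfactorial (α.erase i₀) := by
      unfold mfactorial
      rw [← Finset.mul_prod_erase Finset.univ _ (Finset.mem_univ i₀),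
        ← Finset.mul_prod_erase Finset.univ (fun i => (((α.erase i₀) i) ! : ℝ)) (Finset.mem_univ i₀)]
      simp only [Finsupp.erase_same, Nat.factorial_zero, Nat.cast_one, one_mul]
      congr 1
      refine Finset.prod_congr rfl fun i hi => ?_
      rw [Finsupp.erase_ne (Finset.ne_of_mem_erase hi)]
    by_cases h0 : α i₀ = 0
    · have : ¬ (1 ≤ α i₀ ∧ α.erase i₀ ≠ 0) := fun h => by omega
      rw [if_neg this]
      simp [h0]
    · by_cases h1 : α.erase i₀ = 0
      · have : ¬ (1 ≤ α i₀ ∧ α.erase i₀ ≠ 0) := fun h => h.2 h1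
        rw [if_neg this, h1]
        simp [mfactorial]
      · have : 1 ≤ α i₀ ∧ α.erase i₀ ≠ 0 := ⟨Nat.one_le_iff_ne_zero.2 h0, h1⟩
        rw [if_pos this, hfac]
        simp [h0, h1]
        ring
  · rw [if_neg hαβ]
    -- either the `i₀`-coordinates differ or the erased parts differ
    by_cases hi : α i₀ = β i₀
    · have he : α.erase i₀ ≠ β.erase i₀ := by
        intro he
        apply hαβ
        ext i
        by_cases hii : i = i₀
        · rw [hii, hi]
        · have := congrArg (fun f : ι →₀ ℕ => f i) he
          simpa [Finsupp.erase_ne hii] using this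
      have h2 : (2 * ((if α.erase i₀ = β.erase i₀ then mfactorial (α.erase i₀) else 0) -
          (if α.erase i₀ = 0 then (1 : ℝ) else 0) * (if β.erase i₀ = 0 then 1 else 0))) = 0 := by
        rw [if_neg he]
        by_cases ha : α.erase i₀ = 0
        · have hb : β.erase i₀ ≠ 0 := fun hb => he (by rw [ha, hb])
          simp [ha, hb]
        · simp [ha]
      rw [h2, mul_zero]
    · have h1 : (2 * ((if α i₀ = β i₀ then ((β i₀) ! : ℝ) else 0) -
          (if α i₀ = 0 then (1 : ℝ) else 0) * (if β i₀ = 0 then 1 else 0))) = 0 := by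
        rw [if_neg hi]
        by_cases ha : α i₀ = 0
        · have hb : β i₀ ≠ 0 := fun hb => hi (by rw [ha, hb])
          simp [ha, hb]
        · simp [ha]
      rw [h1, zero_mul]

/-! ### The mixed-energy identity -/

omit [DecidableEq ι] in
/-- Integrability of the products of two rectangle modes. [folklore] -/
theorem integrable_incr_mode_mul (b : OrthonormalBasis ι ℝ E) (i₀ : ι) (α β : ι →₀ ℕ) :
    Integrable (fun q : (ℝ × ℝ) × (E × E) =>
      (((hermiteR (α i₀)).eval q.1.1 - (hermiteR (α i₀)).eval q.1.2) *
          (hermiteProd b (α.erase i₀) q.2.1 - hermiteProd b (α.erase i₀) q.2.2)) *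
        (((hermiteR (β i₀)).eval q.1.1 - (hermiteR (β i₀)).eval q.1.2) *
          (hermiteProd b (β.erase i₀) q.2.1 - hermiteProd b (β.erase i₀) q.2.2)))
      (((gaussianReal 0 1).prod (gaussianReal 0 1)).prod ((stdGaussian E).prod (stdGaussian E))) := by
  -- regroup as (function of `(c, s)`) × (function of `(z, z_*)`); expand each factor into
  -- products `f(c) g(s)`, `f(z) g(z_*)`
  set γ₁ := gaussianReal 0 1
  have hA : Integrable (fun x : ℝ × ℝ => ((hermiteR (α i₀)).eval x.1 - (hermiteR (α i₀)).eval x.2) *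
      ((hermiteR (β i₀)).eval x.1 - (hermiteR (β i₀)).eval x.2)) (γ₁.prod γ₁) := by
    have hexp : (fun x : ℝ × ℝ => ((hermiteR (α i₀)).eval x.1 - (hermiteR (α i₀)).eval x.2) *
        ((hermiteR (β i₀)).eval x.1 - (hermiteR (β i₀)).eval x.2)) = fun x =>
        (hermiteR (α i₀)).eval x.1 * (hermiteR (β i₀)).eval x.1 -
          (hermiteR (α i₀)).eval x.1 * (hermiteR (β i₀)).eval x.2 -
          (hermiteR (β i₀)).eval x.1 * (hermiteR (α i₀)).eval x.2 +
          (hermiteR (α i₀)).eval x.2 * (hermiteR (β i₀)).eval x.2 := by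
      funext x; ring
    rw [hexp]
    refine ((Integrable.sub (Integrable.sub ?_ ?_) ?_).add ?_)
    · exact ((integrable_eval_mul_eval_gaussianReal (hermiteR (α i₀)) (hermiteR (β i₀)) 0 1).mul_prod
        (integrable_const (μ := γ₁) (1 : ℝ))).congr (ae_of_all _ fun x => by simp)
    · exact (integrable_eval_gaussianReal (hermiteR (α i₀)) 0 1).mul_prod
        (integrable_eval_gaussianReal (hermiteR (β i₀)) 0 1)
    · exact (integrable_eval_gaussianReal (hermiteR (β i₀)) 0 1).mul_prod
        (integrable_eval_gaussianReal (hermiteR (α i₀)) 0 1)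
    · exact ((integrable_const (μ := γ₁) (1 : ℝ)).mul_prod
        (integrable_eval_mul_eval_gaussianReal (hermiteR (α i₀)) (hermiteR (β i₀)) 0 1)).congr
        (ae_of_all _ fun x => by simp)
  have hB : Integrable (fun x : E × E => (hermiteProd b (α.erase i₀) x.1 - hermiteProd b (α.erase i₀) x.2) *
      (hermiteProd b (β.erase i₀) x.1 - hermiteProd b (β.erase i₀) x.2))
      ((stdGaussian E).prod (stdGaussian E)) := by
    have hexp : (fun x : E × E => (hermiteProd b (α.erase i₀) x.1 - hermiteProd b (α.erase i₀) x.2) *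
        (hermiteProd b (β.erase i₀) x.1 - hermiteProd b (β.erase i₀) x.2)) = fun x =>
        hermiteProd b (α.erase i₀) x.1 * hermiteProd b (β.erase i₀) x.1 -
          hermiteProd b (α.erase i₀) x.1 * hermiteProd b (β.erase i₀) x.2 -
          hermiteProd b (β.erase i₀) x.1 * hermiteProd b (α.erase i₀) x.2 +
          hermiteProd b (α.erase i₀) x.2 * hermiteProd b (β.erase i₀) x.2 := by
      funext x; ring
    rw [hexp]
    refine ((Integrable.sub (Integrable.sub ?_ ?_) ?_).add ?_)
    · exact ((integrable_hermiteProd_mul_hermiteProd b (α.erase i₀) (β.erase i₀)).mul_prod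
        (integrable_const (μ := stdGaussian E) (1 : ℝ))).congr (ae_of_all _ fun x => by simp)
    · exact (integrable_hermiteProd b (α.erase i₀)).mul_prod (integrable_hermiteProd b (β.erase i₀))
    · exact (integrable_hermiteProd b (β.erase i₀)).mul_prod (integrable_hermiteProd b (α.erase i₀))
    · exact ((integrable_const (μ := stdGaussian E) (1 : ℝ)).mul_prod
        (integrable_hermiteProd_mul_hermiteProd b (α.erase i₀) (β.erase i₀))).congr
        (ae_of_all _ fun x => by simp)
  refine (hA.mul_prod hB).congr (ae_of_all _ fun q => ?_)
  ring

/-- **The mixed-energy identity.** For `ω = bᵢ₀` and a Wick polynomial `g = 𝓗_b p`,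
`∫ (R g)² d((γ₁ ⊗ γ₁) ⊗ (γ ⊗ γ)) = 4 · mixedEnergy i₀ p`: the rectangle increment along a
coordinate direction retains exactly the Hermite modes that depend on that coordinate *and* on
the others, isometrically up to the factor `4`. [folklore] -/
theorem integral_rectIncr_sq_hermiteEval (b : OrthonormalBasis ι ℝ E) (i₀ : ι)
    (p : MvPolynomial ι ℝ) :
    ∫ q, rectIncr (b i₀) (hermiteEval b p) q ^ 2
      ∂(((gaussianReal 0 1).prod (gaussianReal 0 1)).prod ((stdGaussian E).prod (stdGaussian E))) =
      4 * mixedEnergy i₀ p := by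
  classical
  set μ := ((gaussianReal 0 1).prod (gaussianReal 0 1)).prod ((stdGaussian E).prod (stdGaussian E))
  set s := p.support
  -- abbreviations for the modes
  set A : (ι →₀ ℕ) → (ℝ × ℝ) → ℝ := fun α x =>
    (hermiteR (α i₀)).eval x.1 - (hermiteR (α i₀)).eval x.2 with hA
  set K : (ι →₀ ℕ) → (E × E) → ℝ := fun α x =>
    hermiteProd b (α.erase i₀) x.1 - hermiteProd b (α.erase i₀) x.2 with hK
  have hR : ∀ q : (ℝ × ℝ) × (E × E), rectIncr (b i₀) (hermiteEval b p) q =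
      ∑ α ∈ s, MvPolynomial.coeff α p * (A α q.1 * K α q.2) := fun q => by
    rw [rectIncr_hermiteEval]
  have hsq : ∀ q : (ℝ × ℝ) × (E × E), rectIncr (b i₀) (hermiteEval b p) q ^ 2 =
      ∑ α ∈ s, ∑ β ∈ s, (MvPolynomial.coeff α p * MvPolynomial.coeff β p) *
        ((A α q.1 * K α q.2) * (A β q.1 * K β q.2)) := fun q => by
    rw [sq, hR, Finset.sum_mul_sum]
    refine Finset.sum_congr rfl fun α _ => Finset.sum_congr rfl fun β _ => ?_
    ring
  simp_rw [hsq]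
  have hint : ∀ α β, Integrable (fun q : (ℝ × ℝ) × (E × E) =>
      (MvPolynomial.coeff α p * MvPolynomial.coeff β p) *
        ((A α q.1 * K α q.2) * (A β q.1 * K β q.2))) μ := fun α β =>
    (integrable_incr_mode_mul b i₀ α β).const_mul _
  rw [integral_finsetSum _ fun α _ => integrable_finsetSum _ fun β _ => hint α β]
  simp_rw [integral_finsetSum _ fun β _ => hint _ β, integral_const_mul]
  -- each `(α, β)` term factorises
  have hterm : ∀ α β, ∫ q, (A α q.1 * K α q.2) * (A β q.1 * K β q.2) ∂μ =
      (∫ x, A α x * A β x ∂(gaussianReal 0 1).prod (gaussianReal 0 1)) *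
        (∫ x, K α x * K β x ∂(stdGaussian E).prod (stdGaussian E)) := by
    intro α β
    rw [← integral_prod_mul (fun x => A α x * A β x) (fun x => K α x * K β x)]
    exact integral_congr_ae (ae_of_all _ fun q => by ring)
  simp_rw [hterm, hA, hK, integral_hermiteR_incr_mul, integral_hermiteProd_incr_mul,
    incr_expectations_mul i₀]
  simp_rw [mul_ite, mul_zero, Finset.sum_ite_eq]
  rw [mixedEnergy, Finset.mul_sum]
  refine Finset.sum_congr rfl fun α hα => ?_
  rw [if_pos hα]
  split_ifs
  · ring
  · ring

/-- The rectangle increment of a Wick polynomial is square integrable. [folklore] -/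
theorem integrable_rectIncr_sq_hermiteEval (b : OrthonormalBasis ι ℝ E) (i₀ : ι)
    (p : MvPolynomial ι ℝ) :
    Integrable (fun q => rectIncr (b i₀) (hermiteEval b p) q ^ 2)
      (((gaussianReal 0 1).prod (gaussianReal 0 1)).prod ((stdGaussian E).prod (stdGaussian E))) := by
  classical
  have hsq : ∀ q : (ℝ × ℝ) × (E × E), rectIncr (b i₀) (hermiteEval b p) q ^ 2 =
      ∑ α ∈ p.support, ∑ β ∈ p.support, (MvPolynomial.coeff α p * MvPolynomial.coeff β p) *
        ((((hermiteR (α i₀)).eval q.1.1 - (hermiteR (α i₀)).eval q.1.2) *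
          (hermiteProd b (α.erase i₀) q.2.1 - hermiteProd b (α.erase i₀) q.2.2)) *
        (((hermiteR (β i₀)).eval q.1.1 - (hermiteR (β i₀)).eval q.1.2) *
          (hermiteProd b (β.erase i₀) q.2.1 - hermiteProd b (β.erase i₀) q.2.2))) := fun q => by
    rw [sq, rectIncr_hermiteEval, Finset.sum_mul_sum]
    refine Finset.sum_congr rfl fun α _ => Finset.sum_congr rfl fun β _ => ?_
    ring
  simp_rw [hsq]
  exact integrable_finsetSum _ fun α _ => integrable_finsetSum _ fun β _ =>
    (integrable_incr_mode_mul b i₀ α β).const_mul _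

end Gaussian

end

end Literature.Probability.Distributions
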